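import Literature.MathematicalPhysics.QuantumLattice.ExponentialGaugeTransition
import Literature.MathematicalPhysics.QuantumLattice.SegmentParallelTransportUnitary
import Literature.MathematicalPhysics.QuantumLattice.LatticeWilsonFlow
import Literature.Analysis.InnerProduct.ChordShellGeometry
import Mathlib.Analysis.Convex.Segment
import HarnessLib

/-!
# The two chord gauges on a spherical shell of `ℝ⁴`: smallness and near-constancy of the transition

QuantumLattice support file (everything proved; no definitions, no named facts) on the proof
path of `Literature.MathematicalPhysics.QuantumLattice.Waldron2019_yangMillsFlow_flatTorus`
(A. Waldron, Invent. math. 217 (2019)), Lemma 3.5 / §4: the gluing of a global small gauge near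
the sphere `S_r ⊂ ℝ⁴` (matrix coefficients, Frobenius norm). For a `𝔲(N)`-valued `C²`
connection `A` whose curvature is bounded by `ε/r²` on the solid shell `r/4 ≤ ‖w‖ ≤ 2r`, the
exponential gauges centred at the poles `±c` (`c = r e₀`) satisfy

* `norm_expConn_pole_le` — **`‖Ã_{±c}(z) v‖ ≤ (6/5)(ε/r)‖v‖`** on the thickened caps
  `{r/2 ≤ ‖z‖ ≤ 7r/5, ⟨±c, z⟩ ≥ −(3/10)r²}` (Fock–Schwinger + unitary invariance of the
  Frobenius norm + `chord_mem_shell`);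
* `norm_gaugeTransition_eq` — the transition `h = g₊⁻¹ g₋` is unitary, `‖h(z)‖ = ‖1‖`;
* `norm_gaugeTransition_sub_le_band` — for band points `z, z'` (`3r/4 ≤ ‖·‖ ≤ 13r/10`,
  `|⟨c, ·⟩| ≤ (3/10)r²`) at angle `≤ 90°`, `‖h(z') − h(z)‖ ≤ (156/25)‖1‖ ε`;
* `norm_gaugeTransition_sub_base_le` — **`‖h(z) − h(r e₁)‖ ≤ 19‖1‖ε`** on the band (chain of at
  most three such segments through `±r e₁`, `r e₂`).

References: A. Waldron, Invent. math. 217 (2019), Lemma 3.5 / §4 [Waldron2019]; K. Uhlenbeck,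
Comm. Math. Phys. 83 (1982) [folklore].
-/

noncomputable section

open scoped RealInnerProductSpace Matrix.Norms.Frobenius
open Set Metric
open Literature.Analysis.InnerProduct

namespace Literature.MathematicalPhysics.QuantumLattice

variable {N : ℕ}

local notation "𝔼" => EuclideanSpace ℝ (Fin 4)
local notation "𝕓" => EuclideanSpace.basisFun (Fin 4) ℝ
local notation "𝔤" => Matrix (Fin N) (Fin N) ℂ

/-! ### Unitary invariance of the Frobenius norm, in the forms used below -/

/-- `‖U X‖ = ‖X‖` for `U ∈ unitary`. [folklore] -/
theorem norm_unitary_mul {U : 𝔤} (hU : U ∈ unitary 𝔤) (X : 𝔤) : ‖U * X‖ = ‖X‖ :=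
  Matrix.frobenius_norm_unitaryGroup_mul ⟨U, hU⟩ X

/-- `‖X U‖ = ‖X‖` for `U ∈ unitary`. [folklore] -/
theorem norm_mul_unitary {U : 𝔤} (hU : U ∈ unitary 𝔤) (X : 𝔤) : ‖X * U‖ = ‖X‖ :=
  Matrix.frobenius_norm_mul_unitaryGroup X ⟨U, hU⟩

/-- `‖U‖ = ‖1‖` for `U ∈ unitary`. [folklore] -/
theorem norm_unitary_eq {U : 𝔤} (hU : U ∈ unitary 𝔤) : ‖U‖ = ‖(1 : 𝔤)‖ := by
  rw [← norm_mul_unitary hU 1, one_mul]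

/-! ### The setting -/

/-- Skew-adjointness of the values of `A`. [folklore] -/
def IsSkewValued (A : Connection 𝔼 𝔤) : Prop := ∀ y v, star (A y v) = -A y v

/-- The curvature hypothesis on the solid shell `r/4 ≤ ‖w‖ ≤ 2r`. [folklore] -/
def ShellCurvatureBound (A : Connection 𝔼 𝔤) (r ε : ℝ) : Prop :=
  ∀ w : 𝔼, r / 4 ≤ ‖w‖ → ‖w‖ ≤ 2 * r → ∀ v v' : 𝔼, ‖curvature A w v v'‖ ≤ ε / r ^ 2 * ‖v‖ * ‖v'‖

/-! ### Smallness of the pole gauges on the thickened caps -/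

section Poles

/-- The exponential gauge of a skew-valued connection is unitary (matrix form). [folklore] -/
theorem expGauge_mem_unitary' {A : Connection 𝔼 𝔤} (hA : ContDiff ℝ 1 A) (hskew : IsSkewValued A) (c x : 𝔼) :
    expGauge c A x ∈ unitary 𝔤 :=
  expGauge_mem_unitary hA hskew c x

/-- `(g⁻¹ : units) = star g` as matrices, for the unitary exponential gauge. [folklore] -/
theorem val_expGaugeUnit_inv_eq_star {A : Connection 𝔼 𝔤} (hA : ContDiff ℝ 1 A) (hskew : IsSkewValued A) (c x : 𝔼) :
    (((expGaugeUnit hA c x)⁻¹ : 𝔤ˣ) : 𝔤) = star (expGauge c A x) := by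
  have hu := expGauge_mem_unitary' hA hskew c x
  have h1 : star (expGauge c A x) * expGauge c A x = 1 := (Unitary.mem_iff.1 hu).1
  -- the inverse of a unit is unique
  have h2 : (((expGaugeUnit hA c x)⁻¹ : 𝔤ˣ) : 𝔤) * expGauge c A x = 1 := by
    rw [← val_expGaugeUnit hA c x]; exact Units.inv_mul _
  calc (((expGaugeUnit hA c x)⁻¹ : 𝔤ˣ) : 𝔤)
      = (((expGaugeUnit hA c x)⁻¹ : 𝔤ˣ) : 𝔤) * (expGauge c A x * star (expGauge c A x)) := by
        rw [(Unitary.mem_iff.1 hu).2, mul_one]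
    _ = star (expGauge c A x) := by rw [← mul_assoc, h2, one_mul]

/-- **Unitary invariance kills the gauge in the curvature norm**: `‖F_Ã(w)(u,v)‖ = ‖F_A(w)(u,v)‖`.
[folklore] -/
theorem norm_curvature_expConn {A : Connection 𝔼 𝔤} (hA : ContDiff ℝ 2 A) (hskew : IsSkewValued A) (c w u v : 𝔼) :
    ‖curvature (expConn (hA.of_le (by norm_num)) c) w u v‖ = ‖curvature A w u v‖ := by
  have hA1 : ContDiff ℝ 1 A := hA.of_le (by norm_num)
  rw [curvature_expConn hA c w u v, val_expGaugeUnit_inv_eq_star hA1 hskew c w]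
  have hu := expGauge_mem_unitary' hA1 hskew c w
  rw [norm_mul_unitary hu, norm_unitary_mul (Unitary.star_mem hu)]

/-- **The pole gauge is small on the thickened cap**: for `‖c‖ = r` and `z` with
`r/2 ≤ ‖z‖ ≤ 7r/5`, `⟨c, z⟩ ≥ −(3/10)r²`: `‖Ã_c(z)v‖ ≤ (6/5)(ε/r)‖v‖`. [folklore] -/
theorem norm_expConn_pole_le {A : Connection 𝔼 𝔤} (hA : ContDiff ℝ 2 A) (hskew : IsSkewValued A) {r ε : ℝ} (hr : 0 < r)
    (hε : 0 ≤ ε) (hF : ShellCurvatureBound A r ε) {c : 𝔼} (hc : ‖c‖ = r) {z : 𝔼}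
    (hz1 : r / 2 ≤ ‖z‖) (hz2 : ‖z‖ ≤ 7 / 5 * r) (hcz : -(3 / 10) * r ^ 2 ≤ ⟪c, z⟫) (v : 𝔼) :
    ‖expConn (hA.of_le (by norm_num)) c z v‖ ≤ 6 / 5 * (ε / r) * ‖v‖ := by
  have hzc : ‖z - c‖ ≤ 12 / 5 * r := by
    calc ‖z - c‖ ≤ ‖z‖ + ‖c‖ := norm_sub_le _ _
      _ ≤ 7 / 5 * r + r := add_le_add hz2 hc.le
      _ = 12 / 5 * r := by ring
  have hM : ∀ τ ∈ Icc (0 : ℝ) 1,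
      ‖curvature (expConn (hA.of_le (by norm_num)) c) (c + τ • (z - c)) (z - c) v‖ ≤
        ε / r ^ 2 * ‖z - c‖ * ‖v‖ := by
    intro τ hτ
    rw [norm_curvature_expConn hA hskew]
    have hw := chord_mem_shell hr hc hz1 hz2 hcz hτ
    exact hF _ hw.1 hw.2 _ _
  have h := norm_expConn_le hA c (z - c) v hM
  rw [add_sub_cancel] at h
  calc ‖expConn (hA.of_le (by norm_num)) c z v‖ ≤ ε / r ^ 2 * ‖z - c‖ * ‖v‖ / 2 := h
    _ ≤ ε / r ^ 2 * (12 / 5 * r) * ‖v‖ / 2 := by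
        have : 0 ≤ ε / r ^ 2 := by positivity
        have hv := norm_nonneg v
        nlinarith [mul_le_mul_of_nonneg_left hzc this]
    _ = 6 / 5 * (ε / r) * ‖v‖ := by field_simp; ring

end Poles

/-! ### The transition map on the band -/

section Band

/-- The band around the equator of the shell, relative to the pole `c`. [folklore] -/
def InBand (r : ℝ) (c z : 𝔼) : Prop :=
  3 / 4 * r ≤ ‖z‖ ∧ ‖z‖ ≤ 13 / 10 * r ∧ -(3 / 10) * r ^ 2 ≤ ⟪c, z⟫ ∧ ⟪c, z⟫ ≤ 3 / 10 * r ^ 2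

/-- **The transition map is unitary**, hence `‖h(z)‖ = ‖1‖`. [folklore] -/
theorem gaugeTransition_mem_unitary {A : Connection 𝔼 𝔤} (hA : ContDiff ℝ 1 A) (hskew : IsSkewValued A)
    (c c' x : 𝔼) : gaugeTransition hA c c' x ∈ unitary 𝔤 := by
  unfold gaugeTransition
  rw [val_expGaugeUnit_inv_eq_star hA hskew c x]
  exact Submonoid.mul_mem _ (Unitary.star_mem (expGauge_mem_unitary' hA hskew c x))
    (expGauge_mem_unitary' hA hskew c' x)

/-- `‖h(z)‖ = ‖1‖`. [folklore] -/
theorem norm_gaugeTransition_eq {A : Connection 𝔼 𝔤} (hA : ContDiff ℝ 1 A) (hskew : IsSkewValued A)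
    (c c' x : 𝔼) : ‖gaugeTransition hA c c' x‖ = ‖(1 : 𝔤)‖ :=
  norm_unitary_eq (gaugeTransition_mem_unitary hA hskew c c' x)

/-- **Lipschitz bound for the transition map between the pole gauges** `h = g₊⁻¹ g₋` for band
points at angle `≤ 90°`: `‖h(z') − h(z)‖ ≤ 2 (6/5)(ε/r) ‖1‖ ‖z' − z‖`. [folklore] -/
theorem norm_gaugeTransition_sub_le_band {A : Connection 𝔼 𝔤} (hA : ContDiff ℝ 2 A)
    (hskew : IsSkewValued A) {r ε : ℝ} (hr : 0 < r) (hε : 0 ≤ ε) (hF : ShellCurvatureBound A r ε)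
    {c : 𝔼} (hc : ‖c‖ = r) {z z' : 𝔼} (hz : InBand r c z) (hz' : InBand r c z') (hzz : 0 ≤ ⟪z, z'⟫) :
    ‖gaugeTransition (hA.of_le (by norm_num)) c (-c) z' - gaugeTransition (hA.of_le (by norm_num)) c (-c) z‖ ≤
      2 * (6 / 5 * (ε / r)) * ‖(1 : 𝔤)‖ * ‖z' - z‖ := by
  have hA1 : ContDiff ℝ 1 A := hA.of_le (by norm_num)
  have hc' : ‖-c‖ = r := by rw [norm_neg, hc]
  -- every point of the segment is in the thickened caps of both poles
  have hseg : ∀ w ∈ segment ℝ z z', r / 2 ≤ ‖w‖ ∧ ‖w‖ ≤ 7 / 5 * r ∧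
      -(3 / 10) * r ^ 2 ≤ ⟪c, w⟫ ∧ -(3 / 10) * r ^ 2 ≤ ⟪-c, w⟫ := by
    intro w hw
    rw [segment_eq_image'] at hw
    obtain ⟨τ, ⟨hτ0, hτ1⟩, rfl⟩ := hw
    refine ⟨norm_segment_ge_of_inner_nonneg hr hz.1 hz'.1 hzz hτ0 hτ1, ?_, ?_, ?_⟩
    · exact (norm_segment_le_max z z' hτ0 hτ1).trans ((max_le hz.2.1 hz'.2.1).trans (by linarith))
    · exact inner_segment_ge hz.2.2.1 hz'.2.2.1 hτ0 hτ1
    · refine inner_segment_ge ?_ ?_ hτ0 hτ1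
      · rw [inner_neg_left]; linarith [hz.2.2.2]
      · rw [inner_neg_left]; linarith [hz'.2.2.2]
  have hm : 0 ≤ 6 / 5 * (ε / r) := by positivity
  refine norm_gaugeTransition_sub_le hA1 c (-c) (convex_segment z z') hm (norm_nonneg (1 : 𝔤))
    (fun w hw v => ?_) (fun w hw v => ?_) (fun w hw => (norm_gaugeTransition_eq hA1 hskew c (-c) w).le)
    (left_mem_segment ℝ z z') (right_mem_segment ℝ z z')
  · obtain ⟨h1, h2, h3, -⟩ := hseg w hw
    exact norm_expConn_pole_le hA hskew hr hε hF hc h1 h2 h3 v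
  · obtain ⟨h1, h2, -, h4⟩ := hseg w hw
    exact norm_expConn_pole_le hA hskew hr hε hF hc' h1 h2 h4 v

/-- **The transition map is close to its value at the base point** `p = r e₁` on the whole band
(relative to the pole `c = r e₀`): `‖h(z) − h(p)‖ ≤ 16‖1‖ε`. Chain of at most three band
segments at angle `≤ 90°` through `−p` and `q = r e₂`. [folklore] -/
theorem norm_gaugeTransition_sub_base_le {A : Connection 𝔼 𝔤} (hA : ContDiff ℝ 2 A)
    (hskew : IsSkewValued A) {r ε : ℝ} (hr : 0 < r) (hε : 0 ≤ ε) (hF : ShellCurvatureBound A r ε)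
    {z : 𝔼} (hz : InBand r ((r : ℝ) • 𝕓 0) z) :
    ‖gaugeTransition (hA.of_le (by norm_num)) ((r : ℝ) • 𝕓 0) (-((r : ℝ) • 𝕓 0)) z -
        gaugeTransition (hA.of_le (by norm_num)) ((r : ℝ) • 𝕓 0) (-((r : ℝ) • 𝕓 0)) ((r : ℝ) • 𝕓 1)‖ ≤
      16 * ‖(1 : 𝔤)‖ * ε := by
  set c : 𝔼 := (r : ℝ) • 𝕓 0 with hc_def
  set p : 𝔼 := (r : ℝ) • 𝕓 1 with hp_def
  set q : 𝔼 := (r : ℝ) • 𝕓 2 with hq_def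
  set h := gaugeTransition (hA.of_le (by norm_num)) c (-c) with hh
  have hb1 : ∀ k, ‖(𝕓 : OrthonormalBasis (Fin 4) ℝ 𝔼) k‖ = 1 := fun k =>
    (EuclideanSpace.basisFun (Fin 4) ℝ).orthonormal.1 k
  have hon : ∀ k l, ⟪(𝕓 : OrthonormalBasis (Fin 4) ℝ 𝔼) k, 𝕓 l⟫ = if k = l then (1 : ℝ) else 0 :=
    fun k l => orthonormal_iff_ite.1 (EuclideanSpace.basisFun (Fin 4) ℝ).orthonormal k l
  have hnorm : ∀ k, ‖(r : ℝ) • (𝕓 : OrthonormalBasis (Fin 4) ℝ 𝔼) k‖ = r := fun k => by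
    rw [norm_smul, hb1, mul_one, Real.norm_eq_abs, abs_of_pos hr]
  have hc : ‖c‖ = r := hnorm 0
  have hinner : ∀ k l, ⟪(r : ℝ) • (𝕓 : OrthonormalBasis (Fin 4) ℝ 𝔼) k, (r : ℝ) • 𝕓 l⟫ =
      if k = l then r ^ 2 else 0 := by
    intro k l; rw [inner_smul_left, inner_smul_right, hon]; split_ifs <;> simp; ring
  have hr2 : 0 ≤ 3 / 10 * r ^ 2 := by positivity
  -- the three base points are in the band
  have hband : ∀ k : Fin 4, k ≠ 0 → InBand r c ((r : ℝ) • 𝕓 k) ∧ InBand r c (-((r : ℝ) • 𝕓 k)) := by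
    intro k hk
    have h0 : ⟪c, (r : ℝ) • (𝕓 : OrthonormalBasis (Fin 4) ℝ 𝔼) k⟫ = 0 := by
      rw [hc_def, hinner, if_neg (Ne.symm hk)]
    refine ⟨⟨by rw [hnorm]; linarith, by rw [hnorm]; linarith, by rw [h0]; linarith, by rw [h0]; linarith⟩,
      ⟨by rw [norm_neg, hnorm]; linarith, by rw [norm_neg, hnorm]; linarith,
        by rw [inner_neg_right, h0]; linarith, by rw [inner_neg_right, h0]; linarith⟩⟩
  have hp := (hband 1 (by decide)).1
  have hnp := (hband 1 (by decide)).2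
  have hq := (hband 2 (by decide)).1
  -- one band step costs `2 m ‖1‖ · ‖z' − z‖ ≤ 2 m ‖1‖ (‖z'‖ + ‖z‖)`
  have hstep : ∀ {x y : 𝔼}, InBand r c x → InBand r c y → 0 ≤ ⟪x, y⟫ →
      ‖h y - h x‖ ≤ 2 * (6 / 5 * (ε / r)) * ‖(1 : 𝔤)‖ * (‖y‖ + ‖x‖) := by
    intro x y hx hy hxy
    refine (norm_gaugeTransition_sub_le_band hA hskew hr hε hF hc hx hy hxy).trans ?_
    refine mul_le_mul_of_nonneg_left (norm_sub_le _ _) (by positivity)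
  have hK := norm_nonneg (1 : 𝔤)
  have hm : 0 ≤ 6 / 5 * (ε / r) := by positivity
  have hzn : ‖z‖ ≤ 13 / 10 * r := hz.2.1
  have hpn : ‖p‖ = r := hnorm 1
  have hqn : ‖q‖ = r := hnorm 2
  have hnpn : ‖-p‖ = r := by rw [norm_neg, hpn]
  by_cases hzp : 0 ≤ ⟪z, p⟫
  · -- one step `z → p`
    have h1 := hstep hz hp hzp
    have e3 : ‖(r : ℝ) • (𝕓 : OrthonormalBasis (Fin 4) ℝ 𝔼) 1‖ = r := hpn
    rw [e3] at h1
    calc ‖h z - h p‖ = ‖h p - h z‖ := norm_sub_rev _ _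
      _ ≤ 2 * (6 / 5 * (ε / r)) * ‖(1 : 𝔤)‖ * (r + ‖z‖) := h1
      _ ≤ 2 * (6 / 5 * (ε / r)) * ‖(1 : 𝔤)‖ * (r + 13 / 10 * r) := by
          refine mul_le_mul_of_nonneg_left (by linarith) (by positivity)
      _ = 138 / 25 * ‖(1 : 𝔤)‖ * ε := by field_simp; ring
      _ ≤ 16 * ‖(1 : 𝔤)‖ * ε := by nlinarith
  · -- three steps `z → −p → q → p`
    have hzp' : 0 ≤ ⟪z, -p⟫ := by rw [inner_neg_right]; linarith [not_le.1 hzp]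
    have h1 := hstep hz hnp hzp'
    have h2 := hstep hnp hq (by rw [inner_neg_left, hinner]; simp)
    have h3 := hstep hq hp (by rw [hinner]; simp)
    have e1 : ‖-((r : ℝ) • (𝕓 : OrthonormalBasis (Fin 4) ℝ 𝔼) 1)‖ = r := hnpn
    have e2 : ‖(r : ℝ) • (𝕓 : OrthonormalBasis (Fin 4) ℝ 𝔼) 2‖ = r := hqn
    have e3 : ‖(r : ℝ) • (𝕓 : OrthonormalBasis (Fin 4) ℝ 𝔼) 1‖ = r := hpn
    rw [e1] at h1
    rw [e2, e1] at h2
    rw [e3, e2] at h3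
    calc ‖h z - h p‖ ≤ ‖h z - h (-p)‖ + ‖h (-p) - h q‖ + ‖h q - h p‖ := by
          calc ‖h z - h p‖ = ‖(h z - h (-p)) + (h (-p) - h q) + (h q - h p)‖ := by congr 1; abel
            _ ≤ ‖(h z - h (-p)) + (h (-p) - h q)‖ + ‖h q - h p‖ := norm_add_le _ _
            _ ≤ ‖h z - h (-p)‖ + ‖h (-p) - h q‖ + ‖h q - h p‖ :=
                add_le_add (norm_add_le _ _) le_rfl
      _ ≤ 2 * (6 / 5 * (ε / r)) * ‖(1 : 𝔤)‖ * (r + ‖z‖) +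
            2 * (6 / 5 * (ε / r)) * ‖(1 : 𝔤)‖ * (r + r) +
            2 * (6 / 5 * (ε / r)) * ‖(1 : 𝔤)‖ * (r + r) := by
          refine add_le_add (add_le_add ?_ ?_) ?_
          · rw [norm_sub_rev]; exact h1
          · rw [norm_sub_rev]; exact h2
          · rw [norm_sub_rev]; exact h3
      _ ≤ 2 * (6 / 5 * (ε / r)) * ‖(1 : 𝔤)‖ * (r + 13 / 10 * r) +
            2 * (6 / 5 * (ε / r)) * ‖(1 : 𝔤)‖ * (r + r) +
            2 * (6 / 5 * (ε / r)) * ‖(1 : 𝔤)‖ * (r + r) := by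
          have : 0 ≤ 2 * (6 / 5 * (ε / r)) * ‖(1 : 𝔤)‖ := by positivity
          nlinarith [mul_le_mul_of_nonneg_left (show r + ‖z‖ ≤ r + 13 / 10 * r by linarith) this]
      _ = 378 / 25 * ‖(1 : 𝔤)‖ * ε := by field_simp; ring
      _ ≤ 16 * ‖(1 : 𝔤)‖ * ε := by nlinarith

/-- **The normalized transition `W(z) = h(z) h(p)⋆` is unitary and `‖W(z) − 1‖ ≤ 16‖1‖ε` on the
band.** [folklore] -/
theorem norm_gaugeTransition_mul_star_base_sub_one_le {A : Connection 𝔼 𝔤} (hA : ContDiff ℝ 2 A)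
    (hskew : IsSkewValued A) {r ε : ℝ} (hr : 0 < r) (hε : 0 ≤ ε) (hF : ShellCurvatureBound A r ε)
    {z : 𝔼} (hz : InBand r ((r : ℝ) • 𝕓 0) z) :
    ‖gaugeTransition (hA.of_le (by norm_num)) ((r : ℝ) • 𝕓 0) (-((r : ℝ) • 𝕓 0)) z *
          star (gaugeTransition (hA.of_le (by norm_num)) ((r : ℝ) • 𝕓 0) (-((r : ℝ) • 𝕓 0))
            ((r : ℝ) • 𝕓 1)) - 1‖ ≤ 16 * ‖(1 : 𝔤)‖ * ε := by
  have hA1 : ContDiff ℝ 1 A := hA.of_le (by norm_num)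
  set h := gaugeTransition hA1 ((r : ℝ) • 𝕓 0) (-((r : ℝ) • 𝕓 0)) with hh
  have h0u : h ((r : ℝ) • 𝕓 1) ∈ unitary 𝔤 := gaugeTransition_mem_unitary hA1 hskew _ _ _
  have hs : star (h ((r : ℝ) • 𝕓 1)) ∈ unitary 𝔤 := Unitary.star_mem h0u
  have hid : h ((r : ℝ) • 𝕓 1) * star (h ((r : ℝ) • 𝕓 1)) = 1 := (Unitary.mem_iff.1 h0u).2
  have heq : h z * star (h ((r : ℝ) • 𝕓 1)) - 1 = (h z - h ((r : ℝ) • 𝕓 1)) * star (h ((r : ℝ) • 𝕓 1)) := by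
    rw [sub_mul, hid]
  rw [heq, norm_mul_unitary hs]
  exact norm_gaugeTransition_sub_base_le hA hskew hr hε hF hz

/-- The normalized transition is unitary. [folklore] -/
theorem gaugeTransition_mul_star_mem_unitary {A : Connection 𝔼 𝔤} (hA : ContDiff ℝ 1 A)
    (hskew : IsSkewValued A) (c c' z p : 𝔼) :
    gaugeTransition hA c c' z * star (gaugeTransition hA c c' p) ∈ unitary 𝔤 :=
  Submonoid.mul_mem _ (gaugeTransition_mem_unitary hA hskew c c' z)
    (Unitary.star_mem (gaugeTransition_mem_unitary hA hskew c c' p))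

end Band

end Literature.MathematicalPhysics.QuantumLattice
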